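import Mathlib
import HarnessLib
import Summits.Ventures.LatticeQCDFlow.Exactness.NCMCGeneralSpaceChainMartingale

/-!
# The martingale of a PAIR functional: `ψ(X_t, X_{t+1}) − (κψ)(X_t)` is bounded, orthogonal to the past under every initial law, and its squares obey the law of large numbers from every start under a Doeblin power

HONEST FRAMING: exact (Metropolis-corrected) sampling algorithms for lattice gauge theory;
figures of merit are autocorrelation/cost numbers at stated couplings and volumes; no
continuum-physics claim.

Venture `LatticeQCDFlow` (cell pub-lqcd), topic `Exactness`; FANOUT row 13 (`eng-snf`, GEN-19).
NEW WORK of the cell, not a published result; no definition is introduced; nothing is cited as a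
fact.  `NCMCGeneralSpaceChainMartingale.lean` treated the increments `h(X_{t+1}) − (κh)(X_t)` of a
ONE-variable observable; the engine also reports TWO-TIME statistics — transition / acceptance
frequencies `(1/n) Σ 1_B(X_t) 1_C(X_{t+1})` (GEN-17/18: `acc_fwd`, `acc_rev` of `run_ncmc_chain`;
rows 8/9: sector exit fluxes).  This file is the chain-side input of their CLT
(`NCMCGeneralSpacePairFunctionalCLT.lean`): for a bounded measurable `ψ : S × S → ℝ` the increments
`D_t(x) = ψ(x_t, x_{t+1}) − ∫ ψ(x_t, y) κ(x_t, dy)` are bounded, ORTHOGONAL to every bounded measurable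
function of `(D_0, …, D_{n−1})` under EVERY initial law (a JOINT tower identity from Mathlib's
`Kernel.map_frestrictLe_trajMeasure_compProd_eq_map_trajMeasure`: the law of (history, next point)
is `(history law) ⊗ₘ κ`), and `(1/n) Σ_{t<n} D_t² → ∫∫ (ψ(u,y) − (κψ)(u))² κ(u,dy) π(du)` almost
surely from EVERY initial law under a Doeblin power (GEN-17's two-time Birkhoff
`tendsto_sum_pair_div_ae_of_ergodic` + GEN-18's Liouville step `trajMeasure_eq_one_of_nHit_minorised`).

## Content (`κ` Markov on `S`; `ψ : S × S → ℝ` measurable with `|ψ| ≤ C`;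
## `(κψ)(u) = ∫ ψ(u, y) κ(u, dy)`; `D_t(x) = ψ(x_t, x_{t+1}) − (κψ)(x_t)`)

* `measurable_kopPair`, `abs_kopPair_le` — `u ↦ ∫ ψ(u, y) κ(u, dy)` is measurable and bounded by `C`.
* **`chain_tower_joint`** — for EVERY initial law and every bounded measurable `H` of (history up
  to `a`, next point): `∫ H(x_{≤a}, x_{a+1}) dP_{μ₀} = ∫ (∫ H(x_{≤a}, y) κ(x_a, dy)) dP_{μ₀}`.
* **`chain_pairIncrement_orthogonal`** — `∫ F(D_0, …, D_{n−1}) · D_n dP_{μ₀} = 0`.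
* **`chain_integral_pairIncrement_sq`** — `∫ D_0² dP_π = ∫ (∫ (ψ(u,y) − (κψ)(u))² κ(u,dy)) dπ`;
  **`chain_pairIncrementSq_anyLaw_of_nHit`** — under `(nHit κ m)(z,·) ≥ ε ν` (`ε ≠ 0`), for EVERY
  initial law: `(1/n) Σ_{t<n} D_t² →` that value, `P_{μ₀}`-a.s.

NOT CLAIMED: functionals of more than two consecutive states; unbounded `ψ`.
-/

namespace Summit.Ventures.LatticeQCDFlow.Exactness.GeneralNCMC

open MeasureTheory ProbabilityTheory Set Filter Finset Preorder
open scoped ENNReal Topology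

variable {S : Type*} [MeasurableSpace S]

/-! ## §1 The one-step operator on pair observables and the joint tower identity -/

section Tower

variable (κ : Kernel S S) [IsMarkovKernel κ]

/-- `u ↦ ∫ ψ(u, y) κ(u, dy)` is measurable for a measurable `ψ : S × S → ℝ`. -/
theorem measurable_kopPair {ψ : S × S → ℝ} (hψ : Measurable ψ) :
    Measurable fun u => ∫ y, ψ (u, y) ∂(κ u) :=
  (hψ.stronglyMeasurable.integral_kernel_prod_right' (κ := κ)).measurable

/-- `|∫ ψ(u, y) κ(u, dy)| ≤ C` when `|ψ| ≤ C`. -/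
theorem abs_kopPair_le {ψ : S × S → ℝ} {C : ℝ} (hC : ∀ p, |ψ p| ≤ C) (u : S) :
    |∫ y, ψ (u, y) ∂(κ u)| ≤ C := by
  rw [← Real.norm_eq_abs]
  calc ‖∫ y, ψ (u, y) ∂(κ u)‖ ≤ C * (κ u).real univ :=
        norm_integral_le_of_norm_le_const (Eventually.of_forall fun y => by
          rw [Real.norm_eq_abs]; exact hC (u, y))
    _ = C := by rw [probReal_univ, mul_one]

variable (μ₀ : Measure S) [IsProbabilityMeasure μ₀]

/-- **The joint tower identity**: for every initial law and every bounded measurable `H` of the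
history up to time `a` and the next point,
`∫ H(x_{≤a}, x_{a+1}) dP_{μ₀} = ∫ (∫ H(x_{≤a}, y) κ(x_a, dy)) dP_{μ₀}`. -/
theorem chain_tower_joint (a : ℕ) {H : ((i : ↥(Finset.Iic a)) → S) × S → ℝ} (hH : Measurable H)
    {CH : ℝ} (hCH : ∀ p, |H p| ≤ CH) :
    ∫ x, H (Preorder.frestrictLe a x, x (a + 1)) ∂(Kernel.trajMeasure (X := fun _ : ℕ => S) μ₀
        (fun n : ℕ => κ.comap (fun hh : (i : ↥(Finset.Iic n)) → S => hh ⟨n, Finset.mem_Iic.2 le_rfl⟩)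
          (measurable_pi_apply _)))
      = ∫ x, (∫ y, H (Preorder.frestrictLe a x, y) ∂(κ (x a)))
        ∂(Kernel.trajMeasure (X := fun _ : ℕ => S) μ₀
          (fun n : ℕ => κ.comap (fun hh : (i : ↥(Finset.Iic n)) → S => hh ⟨n, Finset.mem_Iic.2 le_rfl⟩)
            (measurable_pi_apply _))) := by
  set P := Kernel.trajMeasure (X := fun _ : ℕ => S) μ₀
    (fun n : ℕ => κ.comap (fun hh : (i : ↥(Finset.Iic n)) → S => hh ⟨n, Finset.mem_Iic.2 le_rfl⟩)
      (measurable_pi_apply _)) with hP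
  have hcp := Kernel.map_frestrictLe_trajMeasure_compProd_eq_map_trajMeasure (X := fun _ : ℕ => S)
    (μ₀ := μ₀)
    (κ := fun n : ℕ => κ.comap (fun hh : (i : ↥(Finset.Iic n)) → S => hh ⟨n, Finset.mem_Iic.2 le_rfl⟩)
      (measurable_pi_apply _)) (a := a)
  rw [← hP] at hcp
  have hmeas : Measurable fun x : ℕ → S => (Preorder.frestrictLe a x, x (a + 1)) :=
    (measurable_frestrictLe a).prodMk (measurable_pi_apply _)
  have hinner : Measurable fun p : (i : ↥(Finset.Iic a)) → S =>
      ∫ y, H (p, y) ∂(κ (p ⟨a, Finset.mem_Iic.2 le_rfl⟩)) := by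
    have h := (hH.stronglyMeasurable.integral_kernel_prod_right'
      (κ := κ.comap (fun hh : (i : ↥(Finset.Iic a)) → S => hh ⟨a, Finset.mem_Iic.2 le_rfl⟩)
        (measurable_pi_apply _))).measurable
    simpa [Kernel.comap_apply] using h
  have hL : ∫ x, H (Preorder.frestrictLe a x, x (a + 1)) ∂P
      = ∫ p, H p ∂(P.map fun x => (Preorder.frestrictLe a x, x (a + 1))) := by
    rw [integral_map hmeas.aemeasurable hH.aestronglyMeasurable]
  have hR : ∫ x, (∫ y, H (Preorder.frestrictLe a x, y) ∂(κ (x a))) ∂P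
      = ∫ p, (∫ y, H (p, y) ∂(κ (p ⟨a, Finset.mem_Iic.2 le_rfl⟩))) ∂(P.map (Preorder.frestrictLe a)) := by
    rw [integral_map (measurable_frestrictLe a).aemeasurable hinner.aestronglyMeasurable]
    rfl
  rw [hL, hR, ← hcp, Measure.integral_compProd]
  · exact integral_congr_ae (ae_of_all _ fun p => rfl)
  · exact Scoring.integrable_of_bounded _ hH hCH

end Tower

/-! ## §2 Pair increments: orthogonality and the law of large numbers of their squares -/

section Pair

variable (κ : Kernel S S) [IsMarkovKernel κ] (μ₀ : Measure S) [IsProbabilityMeasure μ₀]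

/-- **The pair increments `D_t = ψ(X_t, X_{t+1}) − (κψ)(X_t)` are orthogonal to their past**: for
every initial law, every `n` and every bounded measurable `F : (Fin n → ℝ) → ℝ`,
`∫ F(D_0, …, D_{n−1}) · D_n dP_{μ₀} = 0`. -/
theorem chain_pairIncrement_orthogonal {ψ : S × S → ℝ} (hψ : Measurable ψ) {C : ℝ}
    (hC : ∀ p, |ψ p| ≤ C) (n : ℕ) (F : (Fin n → ℝ) → ℝ) (K : ℝ) (hF : Measurable F)
    (hK : ∀ v, |F v| ≤ K) :
    ∫ x, F (fun i : Fin n => ψ (x (i : ℕ), x ((i : ℕ) + 1)) - ∫ y, ψ (x (i : ℕ), y) ∂(κ (x (i : ℕ))))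
        * (ψ (x n, x (n + 1)) - ∫ y, ψ (x n, y) ∂(κ (x n)))
      ∂(Kernel.trajMeasure (X := fun _ : ℕ => S) μ₀
        (fun n : ℕ => κ.comap (fun hh : (i : ↥(Finset.Iic n)) → S => hh ⟨n, Finset.mem_Iic.2 le_rfl⟩)
          (measurable_pi_apply _))) = 0 := by
  set P := Kernel.trajMeasure (X := fun _ : ℕ => S) μ₀
    (fun n : ℕ => κ.comap (fun hh : (i : ↥(Finset.Iic n)) → S => hh ⟨n, Finset.mem_Iic.2 le_rfl⟩)
      (measurable_pi_apply _)) with hP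
  have hKm := measurable_kopPair κ hψ
  have hKb : ∀ u, |∫ y, ψ (u, y) ∂(κ u)| ≤ C := abs_kopPair_le κ hC
  have hK0 : 0 ≤ K := (abs_nonneg _).trans (hK fun _ => 0)
  have hC0 : 0 ≤ C := by
    obtain ⟨u⟩ : Nonempty S := ⟨Classical.choice (nonempty_of_isProbabilityMeasure μ₀)⟩
    exact (abs_nonneg _).trans (hC (u, u))
  -- the history functional `G(hist) = F(D_0, …, D_{n−1})`
  set G : ((j : ↥(Finset.Iic n)) → S) → ℝ := fun hist =>
    F (fun i : Fin n => ψ (hist ⟨(i : ℕ), Finset.mem_Iic.2 (by omega)⟩,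
        hist ⟨(i : ℕ) + 1, Finset.mem_Iic.2 (by omega)⟩)
      - ∫ y, ψ (hist ⟨(i : ℕ), Finset.mem_Iic.2 (by omega)⟩, y)
        ∂(κ (hist ⟨(i : ℕ), Finset.mem_Iic.2 (by omega)⟩))) with hG
  have hGm : Measurable G := hF.comp (measurable_pi_lambda _ fun i =>
    (hψ.comp ((measurable_pi_apply _).prodMk (measurable_pi_apply _))).sub
      (hKm.comp (measurable_pi_apply _)))
  -- the joint functional `H(hist, y) = G(hist) (ψ(hist_n, y) − (κψ)(hist_n))`
  set H : ((j : ↥(Finset.Iic n)) → S) × S → ℝ := fun p =>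
    G p.1 * (ψ (p.1 ⟨n, Finset.mem_Iic.2 le_rfl⟩, p.2)
      - ∫ y, ψ (p.1 ⟨n, Finset.mem_Iic.2 le_rfl⟩, y) ∂(κ (p.1 ⟨n, Finset.mem_Iic.2 le_rfl⟩))) with hH
  have hHm : Measurable H :=
    (hGm.comp measurable_fst).mul
      ((hψ.comp (((measurable_pi_apply _).comp measurable_fst).prodMk measurable_snd)).sub
        (hKm.comp ((measurable_pi_apply _).comp measurable_fst)))
  have hHb : ∀ p, |H p| ≤ K * (C + C) := fun p => by
    rw [hH]
    dsimp only
    rw [abs_mul]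
    exact mul_le_mul (hK _) ((abs_sub _ _).trans (add_le_add (hC _) (hKb _))) (abs_nonneg _) hK0
  have key := chain_tower_joint κ μ₀ n hHm hHb
  rw [← hP] at key
  -- the inner integral vanishes: `∫ (ψ(u, y) − (κψ)(u)) κ(u, dy) = 0`
  have hinner : ∀ x : ℕ → S, ∫ y, H (Preorder.frestrictLe n x, y) ∂(κ (x n)) = 0 := by
    intro x
    rw [hH]
    dsimp only
    rw [integral_const_mul]
    have hsub : ∫ y, (ψ (Preorder.frestrictLe n x ⟨n, Finset.mem_Iic.2 le_rfl⟩, y) -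
        ∫ y', ψ (Preorder.frestrictLe n x ⟨n, Finset.mem_Iic.2 le_rfl⟩, y')
          ∂(κ (Preorder.frestrictLe n x ⟨n, Finset.mem_Iic.2 le_rfl⟩))) ∂(κ (x n)) = 0 := by
      have hx : Preorder.frestrictLe n x ⟨n, Finset.mem_Iic.2 le_rfl⟩ = x n := rfl
      have hi : Integrable (fun y => ψ (x n, y)) (κ (x n)) :=
        Scoring.integrable_of_bounded _ (show Measurable fun y => ψ (x n, y) from
          hψ.comp measurable_prodMk_left) (fun y => hC (x n, y))
      rw [hx, integral_sub hi (integrable_const _), integral_const, probReal_univ, one_smul,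
        sub_self]
    rw [hsub, mul_zero]
  simp_rw [hinner] at key
  rw [integral_zero] at key
  -- the left side of the tower identity is the claim
  have hlhs : ∀ x : ℕ → S, H (Preorder.frestrictLe n x, x (n + 1))
      = F (fun i : Fin n => ψ (x (i : ℕ), x ((i : ℕ) + 1)) - ∫ y, ψ (x (i : ℕ), y) ∂(κ (x (i : ℕ))))
        * (ψ (x n, x (n + 1)) - ∫ y, ψ (x n, y) ∂(κ (x n))) := fun x => rfl
  simp_rw [hlhs] at key
  exact key

omit [IsMarkovKernel κ] in
/-- Bookkeeping: the pair increment is bounded by `2C`. -/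
theorem abs_pairIncrement_le [IsMarkovKernel κ] {ψ : S × S → ℝ} {C : ℝ} (hC : ∀ p, |ψ p| ≤ C)
    (x : ℕ → S) (t : ℕ) :
    |ψ (x t, x (t + 1)) - ∫ y, ψ (x t, y) ∂(κ (x t))| ≤ 2 * C := by
  calc |ψ (x t, x (t + 1)) - ∫ y, ψ (x t, y) ∂(κ (x t))|
      ≤ |ψ (x t, x (t + 1))| + |∫ y, ψ (x t, y) ∂(κ (x t))| := abs_sub _ _
    _ ≤ C + C := add_le_add (hC _) (abs_kopPair_le κ hC _)
    _ = 2 * C := by ring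

variable {κ} {π : Measure S} [IsProbabilityMeasure π]

/-- **`E_π[D_0²] = ∫ (∫ (ψ(u, y) − (κψ)(u))² κ(u, dy)) π(du)`** under the stationary chain law. -/
theorem chain_integral_pairIncrement_sq (hπ : Kernel.Invariant κ π) {ψ : S × S → ℝ}
    (hψ : Measurable ψ) {C : ℝ} (hC : ∀ p, |ψ p| ≤ C) :
    ∫ x, (ψ (x 0, x 1) - ∫ y, ψ (x 0, y) ∂(κ (x 0))) ^ 2
        ∂(Kernel.trajMeasure (X := fun _ : ℕ => S) π
          (fun n : ℕ => κ.comap (fun hh : (i : ↥(Finset.Iic n)) → S => hh ⟨n, Finset.mem_Iic.2 le_rfl⟩)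
            (measurable_pi_apply _)))
      = ∫ u, (∫ y, (ψ (u, y) - ∫ y', ψ (u, y') ∂(κ u)) ^ 2 ∂(κ u)) ∂π := by
  have hKm := measurable_kopPair κ hψ
  have hKb : ∀ u, |∫ y, ψ (u, y) ∂(κ u)| ≤ C := abs_kopPair_le κ hC
  -- joint tower at time `0` with `H(hist, y) = (ψ(hist_0, y) − (κψ)(hist_0))²`
  set H : ((j : ↥(Finset.Iic 0)) → S) × S → ℝ := fun p =>
    (ψ (p.1 ⟨0, Finset.mem_Iic.2 le_rfl⟩, p.2)
      - ∫ y, ψ (p.1 ⟨0, Finset.mem_Iic.2 le_rfl⟩, y) ∂(κ (p.1 ⟨0, Finset.mem_Iic.2 le_rfl⟩))) ^ 2 with hH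
  have hHm : Measurable H :=
    ((hψ.comp (((measurable_pi_apply _).comp measurable_fst).prodMk measurable_snd)).sub
      (hKm.comp ((measurable_pi_apply _).comp measurable_fst))).pow_const 2
  have hHb : ∀ p, |H p| ≤ (2 * C) ^ 2 := fun p => by
    rw [hH]
    dsimp only
    rw [abs_pow]
    refine pow_le_pow_left₀ (abs_nonneg _) ?_ 2
    calc _ ≤ |ψ (p.1 ⟨0, Finset.mem_Iic.2 le_rfl⟩, p.2)|
          + |∫ y, ψ (p.1 ⟨0, Finset.mem_Iic.2 le_rfl⟩, y) ∂(κ (p.1 ⟨0, Finset.mem_Iic.2 le_rfl⟩))| :=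
          abs_sub _ _
      _ ≤ C + C := add_le_add (hC _) (hKb _)
      _ = 2 * C := by ring
  have key := chain_tower_joint κ π 0 hHm hHb
  have hlhs : ∀ x : ℕ → S, H (Preorder.frestrictLe 0 x, x (0 + 1))
      = (ψ (x 0, x 1) - ∫ y, ψ (x 0, y) ∂(κ (x 0))) ^ 2 := fun x => rfl
  have hrhs : ∀ x : ℕ → S, ∫ y, H (Preorder.frestrictLe 0 x, y) ∂(κ (x 0))
      = (fun u => ∫ y, (ψ (u, y) - ∫ y', ψ (u, y') ∂(κ u)) ^ 2 ∂(κ u)) (x 0) := fun x => rfl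
  simp_rw [hlhs, hrhs] at key
  rw [key]
  -- the time-`0` marginal of the stationary chain is `π`
  have hgm : Measurable fun u => ∫ y, (ψ (u, y) - ∫ y', ψ (u, y') ∂(κ u)) ^ 2 ∂(κ u) := by
    have h2 : Measurable fun p : S × S => (ψ p - ∫ y', ψ (p.1, y') ∂(κ p.1)) ^ 2 :=
      (hψ.sub (hKm.comp measurable_fst)).pow_const 2
    exact (h2.stronglyMeasurable.integral_kernel_prod_right' (κ := κ)).measurable
  have hgb : ∀ u, |∫ y, (ψ (u, y) - ∫ y', ψ (u, y') ∂(κ u)) ^ 2 ∂(κ u)| ≤ (2 * C) ^ 2 := by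
    intro u
    rw [← Real.norm_eq_abs]
    calc _ ≤ (2 * C) ^ 2 * (κ u).real univ :=
          norm_integral_le_of_norm_le_const (Eventually.of_forall fun y => by
            rw [Real.norm_eq_abs, abs_pow]
            refine pow_le_pow_left₀ (abs_nonneg _) ?_ 2
            calc _ ≤ |ψ (u, y)| + |∫ y', ψ (u, y') ∂(κ u)| := abs_sub _ _
              _ ≤ C + C := add_le_add (hC _) (hKb _)
              _ = 2 * C := by ring)
      _ = (2 * C) ^ 2 := by rw [probReal_univ, mul_one]
  exact Scoring.chain_marginal hπ 0 hgm hgb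

variable {ν : Measure S} [IsProbabilityMeasure ν] {ε : ℝ≥0∞} {m : ℕ}

/-- **LLN for the squared pair increments from EVERY initial law under a Doeblin power**:
`(1/n) Σ_{t<n} (ψ(x_t, x_{t+1}) − (κψ)(x_t))² → ∫ (∫ (ψ(u,y) − (κψ)(u))² κ(u,dy)) dπ` `P_{μ₀}`-a.s. -/
theorem chain_pairIncrementSq_anyLaw_of_nHit (hπ : Kernel.Invariant κ π) (hε : ε ≠ 0)
    (hmin : ∀ z, ε • ν ≤ nHit κ m z) {ψ : S × S → ℝ} (hψ : Measurable ψ) {C : ℝ}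
    (hC : ∀ p, |ψ p| ≤ C) (μ₀ : Measure S) [IsProbabilityMeasure μ₀] :
    ∀ᵐ x ∂(Kernel.trajMeasure (X := fun _ : ℕ => S) μ₀
        (fun n : ℕ => κ.comap (fun hh : (i : ↥(Finset.Iic n)) → S => hh ⟨n, Finset.mem_Iic.2 le_rfl⟩)
          (measurable_pi_apply _))),
      Tendsto (fun n : ℕ => (∑ t ∈ range n,
          (ψ (x t, x (t + 1)) - ∫ y, ψ (x t, y) ∂(κ (x t))) ^ 2) / n) atTop
        (𝓝 (∫ u, (∫ y, (ψ (u, y) - ∫ y', ψ (u, y') ∂(κ u)) ^ 2 ∂(κ u)) ∂π)) := by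
  set L : ℝ := ∫ u, (∫ y, (ψ (u, y) - ∫ y', ψ (u, y') ∂(κ u)) ^ 2 ∂(κ u)) ∂π with hL
  have hKm := measurable_kopPair κ hψ
  have hKb : ∀ u, |∫ y, ψ (u, y) ∂(κ u)| ≤ C := abs_kopPair_le κ hC
  have hΦm : Measurable fun p : S × S => (ψ p - ∫ y', ψ (p.1, y') ∂(κ p.1)) ^ 2 :=
    (hψ.sub (hKm.comp measurable_fst)).pow_const 2
  -- under `P_π`: two-time Birkhoff
  have hErg := ergodic_shift_chain_of_nHit_minorised (κ := κ) hπ hε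
    (fun z t ht => minorised_setwise hmin z ht)
  have hπae : ∀ᵐ x ∂(Kernel.trajMeasure (X := fun _ : ℕ => S) π
      (fun n : ℕ => κ.comap (fun hh : (i : ↥(Finset.Iic n)) → S => hh ⟨n, Finset.mem_Iic.2 le_rfl⟩)
        (measurable_pi_apply _))),
      Tendsto (fun n : ℕ => (∑ t ∈ range n,
          (ψ (x t, x (t + 1)) - ∫ y, ψ (x t, y) ∂(κ (x t))) ^ 2) / n) atTop (𝓝 L) := by
    have hint : Integrable (fun x : ℕ → S => (ψ (x 0, x 1) - ∫ y, ψ (x 0, y) ∂(κ (x 0))) ^ 2)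
        (Kernel.trajMeasure (X := fun _ : ℕ => S) π
          (fun n : ℕ => κ.comap (fun hh : (i : ↥(Finset.Iic n)) → S => hh ⟨n, Finset.mem_Iic.2 le_rfl⟩)
            (measurable_pi_apply _))) :=
      Scoring.integrable_of_bounded _
        (hΦm.comp ((measurable_pi_apply 0).prodMk (measurable_pi_apply 1)))
        (C := (2 * C) ^ 2) fun x => by
          rw [abs_pow]
          exact pow_le_pow_left₀ (abs_nonneg _) (abs_pairIncrement_le κ hC x 0) 2
    have hB := tendsto_sum_pair_div_ae_of_ergodic hErg
      (φ := fun a b => (ψ (a, b) - ∫ y, ψ (a, y) ∂(κ a)) ^ 2) hint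
    rwa [chain_integral_pairIncrement_sq hπ hψ hC] at hB
  -- the Cesàro event is measurable and shift-invariant: Liouville step
  have hA : MeasurableSet {x : ℕ → S | Tendsto (fun n : ℕ => (∑ t ∈ range n,
      (ψ (x t, x (t + 1)) - ∫ y, ψ (x t, y) ∂(κ (x t))) ^ 2) / n) atTop (𝓝 L)} :=
    measurableSet_tendsto (𝓝 L) fun n =>
      (Finset.measurable_sum (range n) fun t _ =>
        hΦm.comp ((measurable_pi_apply t).prodMk (measurable_pi_apply (t + 1)))).div_const _
  have hinv : (fun (x : ℕ → S) (k : ℕ) => x (k + 1)) ⁻¹' {x : ℕ → S | Tendsto (fun n : ℕ =>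
      (∑ t ∈ range n, (ψ (x t, x (t + 1)) - ∫ y, ψ (x t, y) ∂(κ (x t))) ^ 2) / n) atTop (𝓝 L)}
      = {x : ℕ → S | Tendsto (fun n : ℕ =>
        (∑ t ∈ range n, (ψ (x t, x (t + 1)) - ∫ y, ψ (x t, y) ∂(κ (x t))) ^ 2) / n) atTop (𝓝 L)} := by
    ext x
    simp only [Set.mem_preimage, Set.mem_setOf_eq]
    exact tendsto_cesaro_shift_iff (fun p : S × S => (ψ p - ∫ y, ψ (p.1, y) ∂(κ p.1)) ^ 2)
      (fun t => (x t, x (t + 1))) L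
  have hπA : Kernel.trajMeasure (X := fun _ : ℕ => S) π
      (fun n : ℕ => κ.comap (fun hh : (i : ↥(Finset.Iic n)) → S => hh ⟨n, Finset.mem_Iic.2 le_rfl⟩)
        (measurable_pi_apply _)) {x : ℕ → S | Tendsto (fun n : ℕ =>
        (∑ t ∈ range n, (ψ (x t, x (t + 1)) - ∫ y, ψ (x t, y) ∂(κ (x t))) ^ 2) / n) atTop (𝓝 L)}
      = 1 := by
    rw [ae_iff, ← Set.compl_setOf] at hπae
    exact (prob_compl_eq_zero_iff hA).1 hπae
  have h1 := trajMeasure_eq_one_of_nHit_minorised hπ hε hmin hA hinv hπA μ₀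
  rw [ae_iff, ← Set.compl_setOf]
  exact (prob_compl_eq_zero_iff hA).2 h1

end Pair

end Summit.Ventures.LatticeQCDFlow.Exactness.GeneralNCMC
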